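import Summits.BirchSwinnertonDyer.BirchSwinnertonDyer.Theorems.BiquadraticEisensteinDescentHeegnerTwistCouplingInSupplyQuarticMinusTripleCubeCorner
import Summits.BirchSwinnertonDyer.BirchSwinnertonDyer.Theorems.BiquadraticEisensteinDescentHeegnerTwistCouplingInSupplyQuarticMinusTripleRows
import HarnessLib

set_option linter.dupNamespace false -- `Summit.BirchSwinnertonDyer.BirchSwinnertonDyer.Theorems.…` (summit = sub)
set_option autoImplicit false

/-!
# Crux `HeegnerTwistCouplingInSupply` (stmt-BirchSwinnertonDyer-21381) — the QUARTIC `j = 1728` corner, CUBE member `W_{p³}⁻ : y² = x³ − p³·x`: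
# ★★ the corner for EVERY prime `p ≡ 7 (mod 8)` with `23 ≤ p < 6000`, modulo Burungale–Tian ONLY; binder-free form; crux body on the family

Route `BiquadraticEisensteinDescent` (cell `pub/bsd-wall`, width seat `bsd-wall-cm-bed-w4` g14; `--supports` 21381, helper). The kernel rows of
`…QuarticMinusTripleRows.exists_tripleData_of_lt` (one triple `(s, q, ℓ)` per prime `p ≡ 7 (mod 8)`, `23 ≤ p < 6000`, with
`(s/p) = (q/p) = (ℓ/p) = −1`, `h(−sqℓ) < p`) feed the cube member's generic rung `…QuarticMinusTripleCubeCorner.cruxOnQuarticMinusCubeCornerTriple_of_BT`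
verbatim: ★★ `cruxOnQuarticMinusCubeCornerBelow_of_BT`; with the instance binders of the literal `W_{p³}⁻` discharged (`isElliptic_Wcube`,
`isGloballyMinimal_Wcube` — `Δ = 64p⁹`, `ord_p Δ = 9 < 12`, Silverman VII.1.1 via `isGloballyMinimal_of_int_criterion` — and `conductorNorm_pos_holds`):
★★ `cruxOnQuarticMinusCubeCornerBelow`; and the crux BODY verbatim on the family `{W_{n³}⁻ : n prime, n ≡ 7 (mod 8), 23 ≤ n < 6000}`:
★★ `heegnerTwistCouplingInSupply_of_eq_Wcube_lt` (`¬ Good ∧ 5 ≤ p` force `p = n`, `eq_of_not_good_Wcube`).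

HONEST FRAMING: a typed sub-corner on ONE CM curve per prime, on a FINITE range; the crux (all CM `W`; residual C⁺) is untouched; BSD is not
proved by any of this. THEOREMS ONLY (no definition, no new named fact, no `sorry`). Supports stmt-BirchSwinnertonDyer-21381.
-/

noncomputable section

open scoped Classical NumberField

namespace Summit.BirchSwinnertonDyer.BirchSwinnertonDyer.Theorems.BiquadraticEisensteinDescentHeegnerTwistCouplingInSupplyQuarticMinusTripleCubeBelow

open _root_.WeierstrassCurve Literature.NumberTheory.EllipticCurves Literature.NumberTheory.EllipticCurves.Rank1Residual
open Literature.NumberTheory.QuadraticFields Literature.NumberTheory.QuadraticFields.Quadratic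
open Summit.BirchSwinnertonDyer.BirchSwinnertonDyer.Theorems.BiquadraticEisensteinDescentHeegnerTwistCouplingInSupplyQuarticMinusTripleCubeCorner
  (cruxOnQuarticMinusCubeCornerTriple_of_BT hasGoodReductionAtPrime_Wcube)
open Summit.BirchSwinnertonDyer.BirchSwinnertonDyer.Theorems.BiquadraticEisensteinDescentHeegnerTwistCouplingInSupplyQuarticMinusTripleRows
  (exists_tripleData_of_lt)

/-! ## §1 ★★ The cube member's corner below `6000` -/

/-- ★★ **THE CUBE MEMBER'S CORNER BELOW `6000`, ONE NAMED FACT.** For every prime `p ≡ 7 (mod 8)` with `23 ≤ p < 6000` and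
`W = W_{p³}⁻ : y² = x³ − p³·x`: modulo Burungale–Tian ONLY there is a Heegner field `K′` of `N(W)` with `4 < |d_{K′}|`, `L(W^{(d_{K′})}, 1) ≠ 0`,
`h(K′) < p` and `p ∤ h(K′)` — the CONCLUSION of crux 21381 for `W` (generic cube rung + the kernel rows of `…QuarticMinusTripleRows`).
[cite: BurungaleTian2026, Thm. 1.1] [cite: SilvermanAEC2009, Prop. X.4.9 and Thm. X.4.2(a)] [cite: Cohen1993, §5.3.1 Algorithm 5.3.5] -/
theorem cruxOnQuarticMinusCubeCornerBelow_of_BT (hBT : burungaleTian_analyticRank_eq_zero_of_selmerCorank_eq_zero_of_hasCM) :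
    ∀ (p : ℕ) [Fact p.Prime] [(⟨0, 0, 0, -(p : ℚ) ^ 3, 0⟩ : WeierstrassCurve ℚ).IsElliptic]
      [(⟨0, 0, 0, -(p : ℚ) ^ 3, 0⟩ : WeierstrassCurve ℚ).IsGloballyMinimal]
      [NeZero ((⟨0, 0, 0, -(p : ℚ) ^ 3, 0⟩ : WeierstrassCurve ℚ).conductorNorm ℤ)],
      p % 8 = 7 → 23 ≤ p → p < 6000 →
      ∃ (K : Type) (_ : Field K) (_ : NumberField K),
        IsImaginaryQuadratic K ∧ 4 < (NumberField.discr K).natAbs ∧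
        SatisfiesHeegnerHypothesis ((⟨0, 0, 0, -(p : ℚ) ^ 3, 0⟩ : WeierstrassCurve ℚ).conductorNorm ℤ) K ∧
        ((⟨0, 0, 0, -(p : ℚ) ^ 3, 0⟩ : WeierstrassCurve ℚ).quadraticTwist (NumberField.discr K : ℚ)).entireLFunction 1 ≠ 0 ∧
        NumberField.classNumber K < p ∧ ¬ p ∣ NumberField.classNumber K := by
  intro p hpF _ _ _ hp8 h23 h6000
  obtain ⟨s, q, l, hs, hq, hl, hs8, hq8, hl8, hJs, hJq, hJl, hh⟩ := exists_tripleData_of_lt hpF.out hp8 h23 h6000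
  exact cruxOnQuarticMinusCubeCornerTriple_of_BT hBT p hp8 s q l hs hq hl hs8 hq8 hl8 hJs hJq hJl hh

/-! ## §2 The crux's instance binders for the literal `W_{p³}⁻` -/

/-- **`W_{p³}⁻ : y² = x³ − p³·x` is an elliptic curve** (`p` prime). [folklore] -/
theorem isElliptic_Wcube (p : ℕ) [Fact p.Prime] : (⟨0, 0, 0, -(p : ℚ) ^ 3, 0⟩ : WeierstrassCurve ℚ).IsElliptic := by
  have h := XCubeAddDX.isElliptic_xD (D := -(p : ℤ) ^ 3)
    (neg_ne_zero.mpr (pow_ne_zero 3 (by exact_mod_cast (Fact.out : p.Prime).ne_zero)))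
  simpa only [Int.cast_neg, Int.cast_pow, Int.cast_natCast] using h

open Literature.NumberTheory.EllipticCurves.Rank1Residual.X11RankOneCertificates in
/-- **`W_{p³}⁻` (`p` an odd prime) is a global minimal model**: the integer model `[0, 0, 0, −p³, 0]` has `Δ = 64 p⁹` (`ord_2 Δ = 6`, `ord_p Δ = 9`,
both `< 12`), so no prime `q` has `q¹² ∣ Δ` (Silverman VII.1 Remark 1.1; the tree's `isGloballyMinimal_of_int_criterion`).
[cite: SilvermanAEC2009, VII.1 Remark 1.1] -/
theorem isGloballyMinimal_Wcube {p : ℕ} (hp : p.Prime) (hp2 : p ≠ 2) :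
    (⟨0, 0, 0, -(p : ℚ) ^ 3, 0⟩ : WeierstrassCurve ℚ).IsGloballyMinimal := by
  have h := isGloballyMinimal_of_int_criterion 0 0 0 (-(p : ℤ) ^ 3) 0 ?_
  · simpa only [Int.cast_zero, Int.cast_neg, Int.cast_pow, Int.cast_natCast] using h
  · rintro q hq ⟨h12, -⟩
    have hΔ : discOf [0, 0, 0, -(p : ℤ) ^ 3, 0] = 64 * (p : ℤ) ^ 9 := by
      simp only [discOf, invariants]
      ring
    rw [hΔ] at h12
    have h12' : q ^ 12 ∣ 64 * p ^ 9 := by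
      have := Int.natAbs_dvd_natAbs.mpr h12
      simpa [Int.natAbs_mul, Int.natAbs_pow] using this
    by_cases hq2 : q = 2
    · subst hq2
      have hcop : Nat.Coprime (2 ^ 12) (p ^ 9) :=
        Nat.Coprime.pow _ _ ((Nat.coprime_primes Nat.prime_two hp).mpr (Ne.symm hp2))
      have h64 : 2 ^ 12 ∣ 64 := hcop.dvd_of_dvd_mul_right h12'
      have := Nat.le_of_dvd (by norm_num) h64
      omega
    · have hcop : Nat.Coprime (q ^ 12) 64 := by
        rw [show (64 : ℕ) = 2 ^ 6 by norm_num]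
        exact Nat.Coprime.pow _ _ ((Nat.coprime_primes hq Nat.prime_two).mpr hq2)
      have hqp : q ^ 12 ∣ p ^ 9 := hcop.dvd_of_dvd_mul_left h12'
      have hq1 : q ∣ p := hq.dvd_of_dvd_pow (dvd_trans (dvd_pow_self q (by norm_num)) hqp)
      have hqeq : q = p := (Nat.prime_dvd_prime_iff_eq hq hp).mp hq1
      subst hqeq
      have := (Nat.pow_dvd_pow_iff_le_right hq.one_lt).mp hqp
      omega

/-- ★★ **The cube member's corner with NO side binders**: an honest closed statement about `y² = x³ − p³·x` for every prime `p ≡ 7 (mod 8)`,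
`23 ≤ p < 6000`, modulo Burungale–Tian ONLY. [cite: BurungaleTian2026, Thm. 1.1] [cite: Cohen1993, §5.3.1 Algorithm 5.3.5] -/
theorem cruxOnQuarticMinusCubeCornerBelow (hBT : burungaleTian_analyticRank_eq_zero_of_selmerCorank_eq_zero_of_hasCM) :
    ∀ (p : ℕ) [Fact p.Prime], p % 8 = 7 → 23 ≤ p → p < 6000 →
      haveI := isElliptic_Wcube p
      ∃ (K : Type) (_ : Field K) (_ : NumberField K),
        IsImaginaryQuadratic K ∧ 4 < (NumberField.discr K).natAbs ∧
        SatisfiesHeegnerHypothesis ((⟨0, 0, 0, -(p : ℚ) ^ 3, 0⟩ : WeierstrassCurve ℚ).conductorNorm ℤ) K ∧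
        ((⟨0, 0, 0, -(p : ℚ) ^ 3, 0⟩ : WeierstrassCurve ℚ).quadraticTwist (NumberField.discr K : ℚ)).entireLFunction 1 ≠ 0 ∧
        NumberField.classNumber K < p ∧ ¬ p ∣ NumberField.classNumber K := by
  intro p hpF hp8 h23 h6000
  have hp : p.Prime := hpF.out
  haveI := isElliptic_Wcube p
  haveI := isGloballyMinimal_Wcube hp (by rintro rfl; omega)
  haveI : NeZero ((⟨0, 0, 0, -(p : ℚ) ^ 3, 0⟩ : WeierstrassCurve ℚ).conductorNorm ℤ) :=
    ⟨((⟨0, 0, 0, -(p : ℚ) ^ 3, 0⟩ : WeierstrassCurve ℚ).conductorNorm_pos_holds).ne'⟩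
  exact cruxOnQuarticMinusCubeCornerBelow_of_BT hBT p hp8 h23 h6000

/-! ## §3 ★★ The crux body, verbatim, on the family `{W_{n³}⁻ : n prime, n ≡ 7 (mod 8), 23 ≤ n < 6000}` -/

/-- **The only bad prime `≥ 5` of `W_{n³}⁻` is `n`** (`n` prime): `W_{n³}⁻` has good reduction at every prime not dividing `2n`.
[cite: SilvermanAEC2009, VII.5 Prop. 5.1(a)] -/
theorem eq_of_not_good_Wcube {n p : ℕ} [Fact p.Prime] (hn : n.Prime) (h5 : 5 ≤ p)
    (hbad : ¬ Good (⟨0, 0, 0, -(n : ℚ) ^ 3, 0⟩ : WeierstrassCurve ℚ) p) : p = n := by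
  have hp : p.Prime := Fact.out
  by_contra hne
  refine hbad (hasGoodReductionAtPrime_Wcube fun hdvd => ?_)
  rcases (Nat.Prime.dvd_mul hp).mp hdvd with h2 | h
  · have := (Nat.prime_dvd_prime_iff_eq hp Nat.prime_two).mp h2
    omega
  · exact hne ((Nat.prime_dvd_prime_iff_eq hp hn).mp h)

/-- ★★ **THE CRUX BODY FOR EVERY `W` IN THE FAMILY `{W_{n³}⁻ : n prime, n ≡ 7 (mod 8), 23 ≤ n < 6000}`** — the universally quantified body of
`HeegnerTwistCouplingInSupply` with the single extra hypothesis `∃ n, n.Prime ∧ n % 8 = 7 ∧ 23 ≤ n ∧ n < 6000 ∧ W = W_{n³}⁻` (`¬ Good ∧ 5 ≤ p`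
force `p = n`), modulo Burungale–Tian ONLY. [cite: BurungaleTian2026, Thm. 1.1] [cite: Cohen1993, §5.3.1 Algorithm 5.3.5] -/
theorem heegnerTwistCouplingInSupply_of_eq_Wcube_lt (hBT : burungaleTian_analyticRank_eq_zero_of_selmerCorank_eq_zero_of_hasCM) :
    ∀ (W : WeierstrassCurve ℚ) [W.IsElliptic] [W.IsGloballyMinimal] (p : ℕ) [Fact p.Prime] [NeZero (W.conductorNorm ℤ)],
      (∃ n : ℕ, n.Prime ∧ n % 8 = 7 ∧ 23 ≤ n ∧ n < 6000 ∧ W = ⟨0, 0, 0, -(n : ℚ) ^ 3, 0⟩) →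
      W.HasCM → W.analyticRank = 1 → 5 ≤ p → CMInert W p → ¬ Good W p →
      (∀ B : ℕ, ∃ (K : Type) (_ : Field K) (_ : NumberField K), IsImaginaryQuadratic K ∧ B < (NumberField.discr K).natAbs ∧
        4 < (NumberField.discr K).natAbs ∧ SatisfiesHeegnerHypothesis (W.conductorNorm ℤ) K ∧ ¬ p ∣ NumberField.classNumber K) →
      ∃ (K : Type) (_ : Field K) (_ : NumberField K),
        IsImaginaryQuadratic K ∧ 4 < (NumberField.discr K).natAbs ∧
        SatisfiesHeegnerHypothesis (W.conductorNorm ℤ) K ∧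
        (W.quadraticTwist (NumberField.discr K : ℚ)).entireLFunction 1 ≠ 0 ∧ ¬ p ∣ NumberField.classNumber K := by
  intro W _ _ p _ _ hW _ _ h5 _ hbad _
  obtain ⟨n, hn, hn8, h23, h6000, rfl⟩ := hW
  obtain rfl := eq_of_not_good_Wcube hn h5 hbad
  obtain ⟨K, iF, iN, hK, h4, hH, hL, -, hndvd⟩ := cruxOnQuarticMinusCubeCornerBelow_of_BT hBT p hn8 h23 h6000
  exact ⟨K, iF, iN, hK, h4, hH, hL, hndvd⟩

end Summit.BirchSwinnertonDyer.BirchSwinnertonDyer.Theorems.BiquadraticEisensteinDescentHeegnerTwistCouplingInSupplyQuarticMinusTripleCubeBelow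

end
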